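/-
Copyright (c) 2026 the pub-hodgecm-mathlib formalisation cell (harness21).  Prover seat hodgecm-mathlib-B-p14 (g35): road «S3-tree» (LEAD F0P3a-plan (g11) WORD T10-2; architect A-p16 (g28)
census «S3» v3 = DEAL SHEET, acting architect F0P3-p01 (g16), ruling A-49 «deliver `(latticeGraph σ ϖ J₀).IsTree` at N = 3 in the form ★ `TreeDisplacement` consumes»),
brick T1 «the `U(3)_v` tree», file T1d-C3 = THE LATTICE GRAPH OF THE SPLIT HERMITIAN 3-SPACE IS A TREE; 2026-09-01.
-/
import Literature.NumberTheory.Automorphic.UnitaryLatticeTreeTypeTwoChild        -- ★ T1d-C3a (B-p14 (g35)): `latticeParent_spec_of_isVertexLattice_two`; brings T1d-B `latticeParent_spec_of_isSelfDualLattice`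
import Literature.Combinatorics.SimpleGraph.TreeRootedCriterionFixedSubtree      -- ★ `RootedTree.isTree_of_parent` (the rooted criterion, Serre I.2.2 Prop. 8)
import HarnessLib

/-!
# The lattice graph of a hermitian space — X: THE LATTICE GRAPH OF `(K³, J₀)` IS A TREE (the Bruhat–Tits tree of the unramified `U(3)`; Bruhat–Tits 1972 §10,
# Tits 1979 §3.3.3, Serre *Trees* II.1.1)

Topic `NumberTheory/Automorphic`; namespace `Literature.NumberTheory.Automorphic.UnitaryLatticeTree`.  THEOREMS ONLY (no definition, no instance, no notation, no named fact,
no `sorry`); kernel lane.  Cell `pub/hodgecm-mathlib` (D-0151), crux H413 = `stmt-HodgeConjecture-24833`; road «S3-tree», brick **T1** (the rank-3 sibling of ★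
`HermitianLatticeTreeIsTree.isTree_latticeTree`), in the currency of ★ T1a `UnitaryLatticeTreeDefs` (`latticeGraph σ ϖ H : SimpleGraph {M // IsVertex σ ϖ H M}`), which is
the hypothesis `hT : G.IsTree` of ★ `TreeDisplacement` (p845190) at `G = latticeGraph σ ϖ ((StdForm.antidiagonal 3).over K)`.
HYPOTHESES: `hd : UnramifiedLocalConjDatum σ ϖ` (★ Cartan `U = K₀·T·K₀`, `2 ∈ 𝒪^×`, `σ` an unramified involution fixing the uniformiser `ϖ`) and `htr₂` = «`U(J₀)` acts transitively on
the type-two vertices» (the rank-3 analogue of the rank-2 binder (hB) of ★ `HermitianLatticeTree`; by Jacobowitz 1962 §7–§8 it holds for every unramified datum with finite residue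
field — discharged separately, brick T1d′).
HONEST LABEL: HC_CM is proved only modulo the 2 remaining named inputs (hLiu418 24832, h413 24833) until rung 0 closes; nothing printed is asserted here (elementary lattice algebra
over a valuation ring + the rooted criterion); S3 stays a print row until the road's END lands.

* §26 DEPTH WITNESSES: `exists_v_mul_pow_le_one`, **`exists_scaleLattice_pow_stdLattice_le_latt`** (every `latt g`, `g ∈ GL_N(K)`, contains some `ϖ^j𝒪^N`),
  `exists_scaleLattice_pow_stdLattice_le_of_isVertexLattice`, `v_det_antidiagonal_three`.
* §27 THE KEY LEMMA **`eq_latticeParent_of_lt`** («every edge is a parent edge»): for vertices `N < L` of the `U(3)` graph, either `L = latticeParent N` or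
  (`L ≠ 𝒪³` and `N = latticeParent L`) — by the depth squeeze `depth L ≤ depth N ≤ depth L + 1` and the duality facts (D1)–(D4).
* §28 **`isTree_latticeGraph_three`**: `(latticeGraph σ ϖ ((StdForm.antidiagonal 3).over K)).IsTree` — ★ `RootedTree.isTree_of_parent` with root `𝒪³`, level
  `2·depth` on self-dual and `2·depth − 1` on type-two vertices, parent `latticeParent`.

## References
* [BruhatTits1972] F. Bruhat, J. Tits, *Groupes réductifs sur un corps local I*, Publ. Math. IHÉS 41 (1972), §10.
* [Tits1979] J. Tits, *Reductive groups over local fields*, PSPM 33.1 (1979), §3.3.3.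
* [Serre1980Trees] J.-P. Serre, *Trees* (1980), Ch. II §1.1; Ch. I §2.2 Prop. 8.
* [Jacobowitz1962] R. Jacobowitz, *Hermitian forms over local fields*, Amer. J. Math. 84 (1962), §7–§8.
-/

set_option autoImplicit false

noncomputable section

open scoped Valued WithZero Matrix MatrixGroups

namespace Literature.NumberTheory.Automorphic.UnitaryLatticeTree

open Literature.NumberTheory.Automorphic Literature.NumberTheory.Automorphic.HermitianLattice
open Literature.NumberTheory.Automorphic.CartanUnique

variable {K : Type*} [Field K] [Valued K ℤᵐ⁰] {σ : K →+* K} {ϖ : K} {N : ℕ}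

/-! ## §26 Depth witnesses: every vertex contains some `ϖ^j𝒪^N` -/

/-- For every `x : K` some `ϖ`-power multiple `x·ϖ^n` is integral (`|ϖ| = exp(−1)`, value group `ℤ`). [cite: Serre1980Trees, II.1.1] -/
theorem exists_v_mul_pow_le_one (hϖ : Valued.v ϖ = WithZero.exp (-1 : ℤ)) (x : K) : ∃ n : ℕ, Valued.v (x * ϖ ^ n) ≤ 1 := by
  by_cases hx : Valued.v x = 0
  · exact ⟨0, by rw [map_mul, hx, zero_mul]; exact zero_le⟩
  · set L := WithZero.log (Valued.v x) with hL
    have hx' : Valued.v x = WithZero.exp L := (WithZero.exp_log hx).symm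
    refine ⟨L.toNat, ?_⟩
    rw [map_mul, map_pow, hϖ, hx', ← WithZero.exp_nsmul, ← WithZero.exp_add, ← WithZero.exp_zero, WithZero.exp_le_exp, nsmul_eq_mul, mul_neg, mul_one]
    have := Int.self_le_toNat L
    omega

/-- **Every full lattice `latt g` (`g ∈ GL_N(K)`) contains some `ϖ^j𝒪^N`** (clear the denominators of `g⁻¹`). [cite: Serre1980Trees, II.1.1] -/
theorem exists_scaleLattice_pow_stdLattice_le_latt (hϖ : Valued.v ϖ = WithZero.exp (-1 : ℤ)) (g : GL (Fin N) K) :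
    ∃ j : ℕ, scaleLattice (ϖ ^ j) (stdLattice K N) ≤ latt (g : Matrix (Fin N) (Fin N) K) := by
  have hϖ0 : ϖ ≠ 0 := uniformizer_ne_zero hϖ
  have hϖ1 : Valued.v ϖ ≤ 1 := by rw [hϖ, ← WithZero.exp_zero, WithZero.exp_le_exp]; omega
  have h : ∀ i j : Fin N, ∃ n : ℕ, Valued.v (((g⁻¹ : GL (Fin N) K) : Matrix (Fin N) (Fin N) K) i j * ϖ ^ n) ≤ 1 := fun i j => exists_v_mul_pow_le_one hϖ _
  choose n hn using h
  refine ⟨∑ i, ∑ j, n i j, ?_⟩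
  rw [scaleLattice_stdLattice_eq_latt_diagonal (pow_ne_zero _ hϖ0), latt_le_latt_iff (Matrix.isUnits_det_units g)]
  intro i j
  rw [Matrix.mul_diagonal, ← Matrix.coe_units_inv]
  have hle : n i j ≤ ∑ i', ∑ j', n i' j' :=
    (Finset.single_le_sum (f := fun j' => n i j') (fun _ _ => Nat.zero_le _) (Finset.mem_univ j)).trans
      (Finset.single_le_sum (f := fun i' => ∑ j', n i' j') (fun _ _ => Nat.zero_le _) (Finset.mem_univ i))
  obtain ⟨c, hc⟩ := Nat.exists_eq_add_of_le hle
  rw [hc, pow_add, ← mul_assoc, map_mul, map_pow]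
  exact mul_le_one' (hn i j) (pow_le_one' hϖ1 _)

/-- Every vertex lattice contains some `ϖ^j𝒪^N` (so its depth is attained: ★ `scaleLattice_latticeDepth_le`). [cite: Serre1980Trees, II.1.1] -/
theorem exists_scaleLattice_pow_stdLattice_le_of_isVertexLattice (hϖ : Valued.v ϖ = WithZero.exp (-1 : ℤ)) {H : Matrix (Fin N) (Fin N) K} {d : ℕ}
    {M : Submodule 𝒪[K] (Fin N → K)} (hM : IsVertexLattice σ ϖ H d M) : ∃ j : ℕ, scaleLattice (ϖ ^ j) (stdLattice K N) ≤ M := by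
  obtain ⟨g, rfl, -⟩ := hM
  exact exists_scaleLattice_pow_stdLattice_le_latt hϖ g

/-- `|det J₀| = 1` for the split form on `K³`. [cite: Tits1979, §3.3.3] -/
theorem v_det_antidiagonal_three : Valued.v ((StdForm.antidiagonal 3).over K).det = 1 := by
  have hJ : ∀ i j : Fin 3, (StdForm.antidiagonal 3).over K i j = if j = Fin.rev i then (1 : K) else 0 := by
    intro i j
    simp only [StdForm.over, Matrix.map_apply, StdForm.antidiagonal_J_apply]
    split_ifs <;> simp
  have hdet : ((StdForm.antidiagonal 3).over K).det = -1 := by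
    rw [Matrix.det_fin_three]; simp [hJ, Fin.rev]
  rw [hdet, Valuation.map_neg, map_one]

/-! ## §27 The key lemma: every edge is a parent edge -/

/-- **EVERY EDGE IS A PARENT EDGE** (`N = 3`, unramified datum, `htr₂`): for vertices `N < L` of the lattice graph — so `N` is of type two and `L` self-dual (★ `type_of_lt_three`) —
the depths satisfy `depth L ≤ depth N ≤ depth L + 1`, and: if `depth N = depth L + 1` then `L = latticeParent N` ((D3) and (D1)); if `depth N = depth L` then
`L ≠ 𝒪³` and `N = latticeParent L` ((D4) and (D2)). [cite: Serre1980Trees, II.1.1] [cite: BruhatTits1972, §10] -/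
theorem eq_latticeParent_of_lt (hd : UnramifiedLocalConjDatum σ ϖ)
    (htr₂ : ∀ M : Submodule 𝒪[K] (Fin 3 → K), IsVertexLattice σ ϖ ((StdForm.antidiagonal 3).over K) 2 M →
      ∃ u : unitaryGroupOfForm σ ((StdForm.antidiagonal 3).over K), M = mapGL (u : GL (Fin 3) K) (latt (Matrix.diagonal ![(1 : K), 1, ϖ])))
    {N L : Submodule 𝒪[K] (Fin 3 → K)} (hN : IsVertex σ ϖ ((StdForm.antidiagonal 3).over K) N) (hL : IsVertex σ ϖ ((StdForm.antidiagonal 3).over K) L)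
    (hlt : N < L) :
    L = latticeParent σ ϖ ((StdForm.antidiagonal 3).over K) N ∨ (L ≠ stdLattice K 3 ∧ N = latticeParent σ ϖ ((StdForm.antidiagonal 3).over K) L) := by
  have hϖ0 : ϖ ≠ 0 := uniformizer_ne_zero hd.vϖ
  obtain ⟨dN, hN⟩ := hN
  obtain ⟨dL, hL⟩ := hL
  obtain ⟨rfl, rfl⟩ := type_of_lt_three hd.vσ hd.vϖ v_det_antidiagonal_three hN hL hlt
  -- the two parents
  obtain ⟨hPNsd, hNlt, hdepN⟩ := latticeParent_spec_of_isVertexLattice_two hd htr₂ hN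
  -- depth witnesses and the squeeze `depth L ≤ depth N ≤ depth L + 1`
  obtain ⟨jN, hjN⟩ := exists_scaleLattice_pow_stdLattice_le_of_isVertexLattice hd.vϖ hN
  obtain ⟨jL, hjL⟩ := exists_scaleLattice_pow_stdLattice_le_of_isVertexLattice hd.vϖ hL
  have hwN := scaleLattice_latticeDepth_le hjN
  have hwL := scaleLattice_latticeDepth_le hjL
  have hle1 : latticeDepth ϖ L ≤ latticeDepth ϖ N := latticeDepth_le_of_le (hwN.trans hlt.le)
  have hle2 : latticeDepth ϖ N ≤ latticeDepth ϖ L + 1 :=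
    latticeDepth_le_of_le ((scaleLattice_pow_succ_stdLattice_le hwL).trans (scaleLattice_le_of_lt hd.vσ isUnit_det_antidiagonal ⟨2, hN⟩ hL hlt.le))
  have hLsd : dualLatt σ ((StdForm.antidiagonal 3).over K) L = L := dualLatt_eq_self_of_isSelfDualLattice hd.vσ isUnit_det_antidiagonal hL
  rcases (show latticeDepth ϖ N = latticeDepth ϖ L + 1 ∨ latticeDepth ϖ N = latticeDepth ϖ L by omega) with hcase | hcase
  · -- `N` is deeper: `L ≤ N^♯ ⊓ ϖ^{1 − depth N}𝒪³ = latticeParent N`, then (D1)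
    left
    refine eq_of_le_of_isVertexLattice hd.vσ hϖ0 hL hPNsd (le_inf ?_ ?_)
    · rw [← hLsd]; exact dualLatt_antitone σ _ hlt.le
    · have h := le_scaleLattice_of_isVertexLattice hd.vσ hϖ0 isUnit_det_antidiagonal isIntMatrix_antidiagonal isIntMatrix_antidiagonal_inv hL hwL
      rwa [hcase, Nat.cast_add, Nat.cast_one, show (1 : ℤ) - ((latticeDepth ϖ L : ℤ) + 1) = -(latticeDepth ϖ L : ℤ) by ring, zpow_neg, zpow_natCast]
  · -- same depth: `L ≠ 𝒪³` (depth `N ≥ 1`) and `N ≤ L^♯ ⊓ ϖ^{1 − depth L}𝒪³ = latticeParent L`, then (D2)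
    right
    have hL0 : L ≠ stdLattice K 3 := by
      rintro rfl
      rw [latticeDepth_stdLattice] at hcase
      omega
    obtain ⟨-, hPL2, -, -⟩ := latticeParent_spec_of_isSelfDualLattice hd hL hL0
    refine ⟨hL0, eq_of_le_of_isVertexLattice hd.vσ hϖ0 hN hPL2 (le_inf ?_ ?_)⟩
    · rw [hLsd]; exact hlt.le
    · rw [← hcase]; exact hNlt.le.trans inf_le_right

/-! ## §28 The lattice graph of `(K³, J₀)` is a tree -/

/-- **THE LATTICE GRAPH OF THE SPLIT HERMITIAN SPACE `(K³, J₀)` IS A TREE** — the Bruhat–Tits tree of the unramified unitary group `U(3)` in the lattice model of ★ T1a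
(vertices: self-dual and type-two lattices; edges: strict inclusion), for an unramified datum `hd` and under `htr₂` («`U(J₀)` transitive on type-two vertices»).
Proof: ★ `RootedTree.isTree_of_parent` with root `𝒪³`, level `2·depth` ∕ `2·depth − 1`, parent ★ `latticeParent`; the parent axioms are ★ `latticeParent_spec_of_isSelfDualLattice`
and ★ `latticeParent_spec_of_isVertexLattice_two`, the edge axiom is `eq_latticeParent_of_lt`.  This is the hypothesis `hT` of ★ `TreeDisplacement` for `U(3)`.
[cite: BruhatTits1972, §10] [cite: Tits1979, §3.3.3] [cite: Serre1980Trees, II.1.1] -/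
theorem isTree_latticeGraph_three (hd : UnramifiedLocalConjDatum σ ϖ)
    (htr₂ : ∀ M : Submodule 𝒪[K] (Fin 3 → K), IsVertexLattice σ ϖ ((StdForm.antidiagonal 3).over K) 2 M →
      ∃ u : unitaryGroupOfForm σ ((StdForm.antidiagonal 3).over K), M = mapGL (u : GL (Fin 3) K) (latt (Matrix.diagonal ![(1 : K), 1, ϖ]))) :
    (latticeGraph σ ϖ ((StdForm.antidiagonal 3).over K)).IsTree := by
  classical
  have hϖ0 : ϖ ≠ 0 := uniformizer_ne_zero hd.vϖ
  have hroot : IsSelfDualLattice σ ϖ ((StdForm.antidiagonal 3).over K) (stdLattice K 3) := isSelfDualLattice_stdLattice_three hd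
  let V := {M : Submodule 𝒪[K] (Fin 3 → K) // IsVertex σ ϖ ((StdForm.antidiagonal 3).over K) M}
  let r : V := ⟨stdLattice K 3, ⟨0, hroot⟩⟩
  let dp : V → ℕ := fun v => if IsSelfDualLattice σ ϖ ((StdForm.antidiagonal 3).over K) v.1 then 2 * latticeDepth ϖ v.1 else 2 * latticeDepth ϖ v.1 - 1
  let p : V → V := fun v => if hv : IsVertex σ ϖ ((StdForm.antidiagonal 3).over K) (latticeParent σ ϖ ((StdForm.antidiagonal 3).over K) v.1) then
    ⟨latticeParent σ ϖ ((StdForm.antidiagonal 3).over K) v.1, hv⟩ else v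
  -- no lattice is both self-dual and of type two
  have hnot : ∀ M : Submodule 𝒪[K] (Fin 3 → K), IsVertexLattice σ ϖ ((StdForm.antidiagonal 3).over K) 2 M → ¬ IsSelfDualLattice σ ϖ ((StdForm.antidiagonal 3).over K) M :=
    fun M h2 h0 => absurd (type_unique hd.vσ hd.vϖ h2 h0) (by norm_num)
  -- the parent axioms
  have hpval : ∀ v : V, v ≠ r → (p v).1 = latticeParent σ ϖ ((StdForm.antidiagonal 3).over K) v.1 ∧
      (latticeGraph σ ϖ ((StdForm.antidiagonal 3).over K)).Adj v (p v) ∧ dp (p v) + 1 = dp v := by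
    intro v hv
    have hv0 : v.1 ≠ stdLattice K 3 := fun h => hv (Subtype.ext h)
    obtain ⟨d, hvd⟩ := v.2
    rcases type_eq_zero_or_two_of_isVertexLattice_three hd.vσ hd.vϖ v_det_antidiagonal_three hvd with rfl | rfl
    · -- `v` self-dual, `v ≠ 𝒪³`: parent of type two, below `v`, same depth `≥ 1`
      obtain ⟨hk, hP2, hPlt, hdep⟩ := latticeParent_spec_of_isSelfDualLattice hd hvd hv0
      have hPv : IsVertex σ ϖ ((StdForm.antidiagonal 3).over K) (latticeParent σ ϖ ((StdForm.antidiagonal 3).over K) v.1) := ⟨2, hP2⟩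
      have hpv : p v = ⟨latticeParent σ ϖ ((StdForm.antidiagonal 3).over K) v.1, hPv⟩ := dif_pos hPv
      refine ⟨by rw [hpv], ?_, ?_⟩
      · rw [hpv, latticeGraph_adj_iff]; exact Or.inr hPlt
      · simp only [dp, hpv, if_pos (show IsSelfDualLattice σ ϖ _ v.1 from hvd), if_neg (hnot _ hP2), hdep]; omega
    · -- `v` of type two: parent self-dual, above `v`, one depth up
      obtain ⟨hP0, hltP, hdep⟩ := latticeParent_spec_of_isVertexLattice_two hd htr₂ hvd
      have hPv : IsVertex σ ϖ ((StdForm.antidiagonal 3).over K) (latticeParent σ ϖ ((StdForm.antidiagonal 3).over K) v.1) := ⟨0, hP0⟩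
      have hpv : p v = ⟨latticeParent σ ϖ ((StdForm.antidiagonal 3).over K) v.1, hPv⟩ := dif_pos hPv
      refine ⟨by rw [hpv], ?_, ?_⟩
      · rw [hpv, latticeGraph_adj_iff]; exact Or.inl hltP
      · simp only [dp, hpv, if_pos (show IsSelfDualLattice σ ϖ _ (latticeParent σ ϖ _ v.1) from hP0), if_neg (hnot _ hvd)]; omega
  refine Literature.Combinatorics.SimpleGraph.RootedTree.isTree_of_parent r dp p (fun v hv => (hpval v hv).2) ?_
  -- every edge is a parent edge (§27)
  have hkey : ∀ v w : V, v.1 < w.1 → (v ≠ r ∧ p v = w) ∨ (w ≠ r ∧ p w = v) := by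
    intro v w hvw
    rcases eq_latticeParent_of_lt hd htr₂ v.2 w.2 hvw with hpar | ⟨hw0, hpar⟩
    · left
      have hv : v ≠ r := by
        intro h
        obtain ⟨d, hvd⟩ := v.2
        obtain ⟨d', hwd⟩ := w.2
        obtain ⟨rfl, -⟩ := type_of_lt_three hd.vσ hd.vϖ v_det_antidiagonal_three hvd hwd hvw
        exact hnot _ hvd (by rw [show v.1 = stdLattice K 3 from congrArg Subtype.val h]; exact hroot)
      exact ⟨hv, Subtype.ext (by rw [(hpval v hv).1]; exact hpar.symm)⟩
    · right
      have hw : w ≠ r := fun h => hw0 (congrArg Subtype.val h)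
      exact ⟨hw, Subtype.ext (by rw [(hpval w hw).1]; exact hpar.symm)⟩
  intro v w hvw
  rw [latticeGraph_adj_iff] at hvw
  rcases hvw with h | h
  · exact hkey v w h
  · exact (hkey w v h).symm

end Literature.NumberTheory.Automorphic.UnitaryLatticeTree

end
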